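import Mathlib.Analysis.Calculus.FDeriv.CompCLM
import Mathlib.Analysis.Calculus.ContDiff.Comp
import HarnessLib

/-!
# The second-order chain rule: `D²(Φ ∘ ψ)(x)(v, w) = D²Φ(ψ x)(Dψ v, Dψ w) + DΦ(ψ x)(D²ψ(x)(v, w))`

Topic `Geometry/Riemannian` (fact seat
`provefact-Literature.Geometry.Riemannian.LawsonMichelsohn1984_surrounding`).  Everything here
is **proved**; no definitions.

The defining functions of the bent hypersurfaces of the surrounding construction are
compositions `Φ ∘ (|Y|, t)` of a planar profile function with the "Fermi data" `(t, Y)` of the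
attaching sphere; their Hessians — the mean-convexity clause of the fact — are computed by the
second-order chain rule, for maps between real normed spaces:

* `fderiv_comp_eventuallyEq_of_contDiffAt` — `D(Φ ∘ ψ) = DΦ(ψ ·) ∘ Dψ` near a point where both
  are `C²`;
* `hasFDerivAt_fderiv_comp`, `fderiv_fderiv_comp_apply_two` — **the second-order chain rule**
  `D²(Φ ∘ ψ)(x)(v, w) = D²Φ(ψ x)(Dψ(x) v, Dψ(x) w) + DΦ(ψ x)(D²ψ(x)(v, w))`.

## References

* H. Cartan, *Calcul différentiel* (1967), Ch. I §5, Thm. 5.4.2 (higher derivatives of a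
  composite). [folklore]
-/

noncomputable section

open Set Function Filter
open scoped Topology

namespace Literature.Geometry.Riemannian

variable {E F G : Type*} [NormedAddCommGroup E] [NormedSpace ℝ E] [NormedAddCommGroup F]
  [NormedSpace ℝ F] [NormedAddCommGroup G] [NormedSpace ℝ G] {ψ : E → F} {Φ : F → G} {x : E}

/-- Near a point where `ψ` and `Φ` are `C²`, `D(Φ ∘ ψ)(z) = DΦ(ψ z) ∘ Dψ(z)`. [folklore] -/
theorem fderiv_comp_eventuallyEq_of_contDiffAt (hψ : ContDiffAt ℝ 2 ψ x) (hΦ : ContDiffAt ℝ 2 Φ (ψ x)) :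
    (fun z => fderiv ℝ (Φ ∘ ψ) z) =ᶠ[𝓝 x] fun z => (fderiv ℝ Φ (ψ z)).comp (fderiv ℝ ψ z) := by
  have h1 : ∀ᶠ z in 𝓝 x, ContDiffAt ℝ 2 ψ z := hψ.eventually (by simp)
  have h2 : ∀ᶠ z in 𝓝 x, ContDiffAt ℝ 2 Φ (ψ z) :=
    hψ.continuousAt.eventually (hΦ.eventually (by simp))
  filter_upwards [h1, h2] with z hz hΦz
  exact fderiv_comp z (hΦz.differentiableAt (by simp)) (hz.differentiableAt (by simp))

/-- **The second-order chain rule** (derivative form): at a point where `ψ` and `Φ` are `C²`,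
`z ↦ D(Φ ∘ ψ)(z)` has derivative
`u ↦ DΦ(ψ x) ∘ (D²ψ(x) u) + (D²Φ(ψ x)(Dψ(x) u)) ∘ Dψ(x)`. [folklore] -/
theorem hasFDerivAt_fderiv_comp (hψ : ContDiffAt ℝ 2 ψ x) (hΦ : ContDiffAt ℝ 2 Φ (ψ x)) :
    HasFDerivAt (fun z => fderiv ℝ (Φ ∘ ψ) z)
      ((ContinuousLinearMap.compL ℝ E F G (fderiv ℝ Φ (ψ x))).comp (fderiv ℝ (fderiv ℝ ψ) x) +
        ((ContinuousLinearMap.compL ℝ E F G).flip (fderiv ℝ ψ x)).comp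
          ((fderiv ℝ (fderiv ℝ Φ) (ψ x)).comp (fderiv ℝ ψ x))) x := by
  have hdψ : HasFDerivAt (fderiv ℝ ψ) (fderiv ℝ (fderiv ℝ ψ) x) x :=
    ((hψ.fderiv_right (m := 1) le_rfl).differentiableAt one_ne_zero).hasFDerivAt
  have hdΦ : HasFDerivAt (fun z => fderiv ℝ Φ (ψ z))
      ((fderiv ℝ (fderiv ℝ Φ) (ψ x)).comp (fderiv ℝ ψ x)) x :=
    ((hΦ.fderiv_right (m := 1) le_rfl).differentiableAt one_ne_zero).hasFDerivAt.comp x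
      (hψ.differentiableAt (by simp)).hasFDerivAt
  exact (hdΦ.clm_comp hdψ).congr_of_eventuallyEq (fderiv_comp_eventuallyEq_of_contDiffAt hψ hΦ)

/-- **The second-order chain rule** (evaluated):
`D²(Φ ∘ ψ)(x)(v, w) = D²Φ(ψ x)(Dψ(x) v, Dψ(x) w) + DΦ(ψ x)(D²ψ(x)(v, w))`. [folklore] -/
theorem fderiv_fderiv_comp_apply_two (hψ : ContDiffAt ℝ 2 ψ x) (hΦ : ContDiffAt ℝ 2 Φ (ψ x))
    (v w : E) :
    fderiv ℝ (fun z => fderiv ℝ (Φ ∘ ψ) z) x v w =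
      fderiv ℝ (fderiv ℝ Φ) (ψ x) (fderiv ℝ ψ x v) (fderiv ℝ ψ x w) +
        fderiv ℝ Φ (ψ x) (fderiv ℝ (fderiv ℝ ψ) x v w) := by
  rw [(hasFDerivAt_fderiv_comp hψ hΦ).fderiv]
  simp only [add_apply, ContinuousLinearMap.comp_apply, ContinuousLinearMap.compL_apply,
    ContinuousLinearMap.flip_apply]
  rw [add_comm]

/-- The second-order chain rule in the `iteratedFDeriv` form of the fact's mean-convexity clause.
[folklore] -/
theorem iteratedFDeriv_two_comp_apply (hψ : ContDiffAt ℝ 2 ψ x) (hΦ : ContDiffAt ℝ 2 Φ (ψ x))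
    (v w : E) :
    iteratedFDeriv ℝ 2 (Φ ∘ ψ) x ![v, w] =
      iteratedFDeriv ℝ 2 Φ (ψ x) ![fderiv ℝ ψ x v, fderiv ℝ ψ x w] +
        fderiv ℝ Φ (ψ x) (iteratedFDeriv ℝ 2 ψ x ![v, w]) := by
  simp only [iteratedFDeriv_two_apply, Matrix.cons_val_zero, Matrix.cons_val_one]
  exact fderiv_fderiv_comp_apply_two hψ hΦ v w

end Literature.Geometry.Riemannian

end
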